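import Summits.HubbardSuperconductivity.HubbardSuperconductivity.Theorems.AnisotropyChordStiffnessFirstMoment
import Literature.MathematicalPhysics.QuantumLattice.SpinSystemProofs

/-!
# Route `AnisotropyChord` / H0 rotor rung: local operator toolkit for the double-commutator bound K1′
# (theory seat memo ROTOR-THEORY-8 §120/§121, work-order W5)

Elementary facts about the bond current `j_{xy}` and the XXZ bond term `h_{xy} = SˣSˣ + SʸSʸ + Δ SᶻSᶻ` (spin ½)
on the `L × L` torus, used by the support-counting proof of `DoubleCommutatorBound`:

* matrix elements: `bondCurrent_self_mulVec_apply`, `spinVec_one_two_apply`, `zzBond_mulVec_apply`;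
* `ℓ²`-contraction bounds: `norm_toLp_le_of_pointwise`, `norm_bondCurrent_mulVec_apply_le`,
  `norm_toLp_bondCurrent_mulVec_le` (`‖j v‖ ≤ ‖v‖/2`), `norm_toLp_kineticBond_mulVec_le`, `norm_toLp_zzBond_mulVec_le`,
  `xxzBond`, `norm_toLp_xxzBond_mulVec_le` (`‖h v‖ ≤ (1/2 + |Δ|/4)‖v‖`);
* adjoint and supports: `bondCurrent_conjTranspose` (`jᴴ = −j`), `isSupportedOn_bondCurrent`, `isSupportedOn_xxzBond`;
* the Hamiltonian as a sum over directed bonds: `hcbHamiltonian_eq_neg_sum_xxzBond` (`L ≥ 3`);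
* Cauchy–Schwarz in `dotProduct` currency: `norm_star_dotProduct_le`.
-/

set_option linter.dupNamespace false

noncomputable section

open Matrix Complex Finset
open scoped ComplexConjugate
open Literature.MathematicalPhysics.QuantumLattice hiding torusPhase torusNorm
open Literature.Probability.LatticeModels
open Summit.HubbardSuperconductivity.HubbardSuperconductivity.Theorems.AnisotropyChord.InsertionEntropy

namespace Summit.HubbardSuperconductivity.HubbardSuperconductivity.Theorems.AnisotropyChord.Stiffness

variable {L : ℕ} [NeZero L]

/-! ## Matrix elements -/

/-- Entries of `Sᶻ` for spin ½: `diag(1/2, −1/2)`. -/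
theorem spinVec_one_two_apply (a l : Fin 2) :
    spinVec 1 2 a l = if a = l then (if a = 0 then (1 / 2 : ℂ) else -(1 / 2 : ℂ)) else 0 := by
  rw [spinVec_one_eq_half_spinHalfPauli]
  fin_cases a <;> fin_cases l <;> simp [spinHalfPauli]

/-- The diagonal "bond current" `j_{xx} = Sᶻ_x`: `(j_{xx} v)(σ) = ± v(σ)/2`. -/
theorem bondCurrent_self_mulVec_apply (x : TorusSite 2 L) (v : TensorIndex (TorusSite 2 L) 2 → ℂ)
    (σ : TensorIndex (TorusSite 2 L) 2) :
    (bondCurrent L x x *ᵥ v) σ = (if σ x = 0 then (1 / 2 : ℂ) else -(1 / 2 : ℂ)) * v σ := by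
  unfold bondCurrent siteSpin
  simp only [Matrix.smul_mulVec, Pi.smul_apply, Matrix.sub_mulVec, Pi.sub_apply, ← Matrix.mulVec_mulVec,
    LiebMattis.onSite_mulVec_apply, spinVec_one_zero_apply, spinVec_one_one_apply,
    Function.update_self, Function.update_idem, smul_eq_mul]
  have fin2 : ∀ t : Fin 2, t = 0 ∨ t = 1 := by decide
  have hup := Function.update_eq_self x σ
  rcases fin2 (σ x) with hx | hx
  · rw [hx] at hup
    simp [hx, hup]
    ring_nf
    rw [Complex.I_sq]
    ring
  · rw [hx] at hup
    simp [hx, hup]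
    ring_nf
    rw [Complex.I_sq]
    ring

/-- `(Sᶻ_x Sᶻ_y v)(σ) = ± v(σ)/4` according to `σ_x = σ_y` or not (`x ≠ y`). -/
theorem zzBond_mulVec_apply {x y : TorusSite 2 L} (hxy : x ≠ y) (v : TensorIndex (TorusSite 2 L) 2 → ℂ)
    (σ : TensorIndex (TorusSite 2 L) 2) :
    ((spinBond 1 2 x y : Op (TorusSite 2 L) 2) *ᵥ v) σ
      = (if σ x = σ y then (1 / 4 : ℂ) else -(1 / 4 : ℂ)) * v σ := by
  rw [spinBond_eq_mul hxy]
  unfold siteSpin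
  rw [onSite_mul_onSite_mulVec_apply hxy]
  simp only [Fin.sum_univ_two, spinVec_one_two_apply]
  have fin2 : ∀ t : Fin 2, t = 0 ∨ t = 1 := by decide
  have e1 : Function.update σ x (σ x) = σ := Function.update_eq_self x σ
  have e2 : Function.update σ y (σ y) = σ := Function.update_eq_self y σ
  rcases fin2 (σ x) with hx | hx <;> rcases fin2 (σ y) with hy | hy <;> rw [hx] at e1 <;> rw [hy] at e2 <;>
    simp [hx, hy, e1, e2] <;> norm_num

/-! ## `ℓ²`-contraction bounds -/

/-- A pointwise domination `‖w σ‖ ≤ c‖v(φ σ)‖` along a bijection `φ` gives `‖w‖ ≤ c‖v‖` in `ℓ²`. -/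
theorem norm_toLp_le_of_pointwise {ι : Type*} [Fintype ι] {v w : ι → ℂ} {c : ℝ} (hc : 0 ≤ c) (φ : ι ≃ ι)
    (h : ∀ σ, ‖w σ‖ ≤ c * ‖v (φ σ)‖) :
    ‖WithLp.toLp 2 w‖ ≤ c * ‖WithLp.toLp 2 v‖ := by
  rw [EuclideanSpace.norm_eq, EuclideanSpace.norm_eq, ← Real.sqrt_sq hc, ← Real.sqrt_mul (sq_nonneg c)]
  apply Real.sqrt_le_sqrt
  rw [Finset.mul_sum]
  have hre : ∑ σ, c ^ 2 * ‖(WithLp.toLp 2 v) σ‖ ^ 2 = ∑ σ, c ^ 2 * ‖v (φ σ)‖ ^ 2 := by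
    exact (Equiv.sum_comp φ (fun τ => c ^ 2 * ‖v τ‖ ^ 2)).symm
  rw [hre]
  refine Finset.sum_le_sum fun σ _ => ?_
  rw [PiLp.toLp_apply]
  have h1 := h σ
  have h0 : 0 ≤ ‖w σ‖ := norm_nonneg _
  nlinarith [norm_nonneg (v (φ σ))]

/-- The configuration bijection `σ ↦ σ ∘ swap x y`. -/
def swapConfig (x y : TorusSite 2 L) : TensorIndex (TorusSite 2 L) 2 ≃ TensorIndex (TorusSite 2 L) 2 where
  toFun σ := σ ∘ Equiv.swap x y
  invFun σ := σ ∘ Equiv.swap x y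
  left_inv σ := by funext z; simp [Equiv.swap_apply_self]
  right_inv σ := by funext z; simp [Equiv.swap_apply_self]

omit [NeZero L] in
/-- `swapConfig x y σ = σ ∘ swap x y`. -/
@[simp] theorem swapConfig_apply (x y : TorusSite 2 L) (σ : TensorIndex (TorusSite 2 L) 2) :
    swapConfig x y σ = σ ∘ Equiv.swap x y := rfl

/-- Pointwise bound `‖(j_{xy} v)(σ)‖ ≤ ‖v(σ ∘ swap x y)‖/2`. -/
theorem norm_bondCurrent_mulVec_apply_le (x y : TorusSite 2 L) (v : TensorIndex (TorusSite 2 L) 2 → ℂ)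
    (σ : TensorIndex (TorusSite 2 L) 2) :
    ‖(bondCurrent L x y *ᵥ v) σ‖ ≤ 1 / 2 * ‖v (σ ∘ Equiv.swap x y)‖ := by
  by_cases hxy : x = y
  · subst hxy
    rw [bondCurrent_self_mulVec_apply, norm_mul]
    have hs : σ ∘ Equiv.swap x x = σ := by funext z; simp [Equiv.swap_self]
    rw [hs]
    have h2 : ‖(if σ x = 0 then (1 / 2 : ℂ) else -(1 / 2 : ℂ))‖ = 1 / 2 := by split_ifs <;> simp
    rw [h2]
  · rw [bondCurrent_mulVec_apply hxy]
    split_ifs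
    · rw [norm_mul]
      have h2 : ‖(1 / 2 : ℂ)‖ = 1 / 2 := by simp
      rw [h2]
    · rw [norm_mul]
      have h2 : ‖-(1 / 2 : ℂ)‖ = 1 / 2 := by simp
      rw [h2]
    · simp only [norm_zero]; positivity

/-- **`‖j_{xy} v‖ ≤ ‖v‖/2`.** -/
theorem norm_toLp_bondCurrent_mulVec_le (x y : TorusSite 2 L) (v : TensorIndex (TorusSite 2 L) 2 → ℂ) :
    ‖WithLp.toLp 2 (bondCurrent L x y *ᵥ v)‖ ≤ 1 / 2 * ‖WithLp.toLp 2 v‖ :=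
  norm_toLp_le_of_pointwise (by norm_num) (swapConfig x y) fun σ => norm_bondCurrent_mulVec_apply_le x y v σ

/-- **`‖(SˣSˣ + SʸSʸ)_{xy} v‖ ≤ ‖v‖/2`** (`x ≠ y`). -/
theorem norm_toLp_kineticBond_mulVec_le {x y : TorusSite 2 L} (hxy : x ≠ y)
    (v : TensorIndex (TorusSite 2 L) 2 → ℂ) :
    ‖WithLp.toLp 2 ((spinBond 1 0 x y + spinBond 1 1 x y : Op (TorusSite 2 L) 2) *ᵥ v)‖
      ≤ 1 / 2 * ‖WithLp.toLp 2 v‖ := by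
  refine norm_toLp_le_of_pointwise (by norm_num) (swapConfig x y) fun σ => ?_
  rw [kineticBond_mulVec_apply hxy, swapConfig_apply]
  split_ifs
  · rw [norm_mul]
    have h2 : ‖(1 / 2 : ℂ)‖ = 1 / 2 := by simp
    rw [h2]
  · simp only [norm_zero]; positivity

/-- **`‖Sᶻ_x Sᶻ_y v‖ ≤ ‖v‖/4`** (`x ≠ y`). -/
theorem norm_toLp_zzBond_mulVec_le {x y : TorusSite 2 L} (hxy : x ≠ y)
    (v : TensorIndex (TorusSite 2 L) 2 → ℂ) :
    ‖WithLp.toLp 2 ((spinBond 1 2 x y : Op (TorusSite 2 L) 2) *ᵥ v)‖ ≤ 1 / 4 * ‖WithLp.toLp 2 v‖ := by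
  refine norm_toLp_le_of_pointwise (by norm_num) (Equiv.refl _) fun σ => ?_
  rw [zzBond_mulVec_apply hxy, norm_mul, Equiv.refl_apply]
  have h2 : ‖(if σ x = σ y then (1 / 4 : ℂ) else -(1 / 4 : ℂ))‖ = 1 / 4 := by split_ifs <;> simp
  rw [h2]

/-- The XXZ bond term `h_{xy} = Sˣ_xSˣ_y + Sʸ_xSʸ_y + Δ Sᶻ_xSᶻ_y` (symmetrised `spinBond` form), so that
`H = −Σ_{bonds} h` (`hcbHamiltonian_eq_neg_sum_xxzBond`). -/
def xxzBond (L : ℕ) [NeZero L] (Δ : ℝ) (x y : TorusSite 2 L) : Op (TorusSite 2 L) 2 :=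
  spinBond 1 0 x y + spinBond 1 1 x y + (Δ : ℂ) • spinBond 1 2 x y

/-- **`‖h_{xy} v‖ ≤ (1/2 + |Δ|/4)‖v‖`** (`x ≠ y`). -/
theorem norm_toLp_xxzBond_mulVec_le (Δ : ℝ) {x y : TorusSite 2 L} (hxy : x ≠ y)
    (v : TensorIndex (TorusSite 2 L) 2 → ℂ) :
    ‖WithLp.toLp 2 (xxzBond L Δ x y *ᵥ v)‖ ≤ (1 / 2 + |Δ| / 4) * ‖WithLp.toLp 2 v‖ := by
  unfold xxzBond
  rw [Matrix.add_mulVec, Matrix.smul_mulVec, WithLp.toLp_add, WithLp.toLp_smul]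
  have h1 := norm_toLp_kineticBond_mulVec_le hxy v
  have h2 := norm_toLp_zzBond_mulVec_le hxy v
  have h3 : ‖(Δ : ℂ) • WithLp.toLp 2 ((spinBond 1 2 x y : Op (TorusSite 2 L) 2) *ᵥ v)‖
      ≤ |Δ| * (1 / 4 * ‖WithLp.toLp 2 v‖) := by
    rw [norm_smul, Complex.norm_real, Real.norm_eq_abs]
    exact mul_le_mul_of_nonneg_left h2 (abs_nonneg Δ)
  calc _ ≤ ‖WithLp.toLp 2 ((spinBond 1 0 x y + spinBond 1 1 x y : Op (TorusSite 2 L) 2) *ᵥ v)‖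
        + ‖(Δ : ℂ) • WithLp.toLp 2 ((spinBond 1 2 x y : Op (TorusSite 2 L) 2) *ᵥ v)‖ := norm_add_le _ _
    _ ≤ 1 / 2 * ‖WithLp.toLp 2 v‖ + |Δ| * (1 / 4 * ‖WithLp.toLp 2 v‖) := add_le_add h1 h3
    _ = (1 / 2 + |Δ| / 4) * ‖WithLp.toLp 2 v‖ := by ring

/-! ## The Hamiltonian as a sum over directed bonds -/

/-- **`H = −Σ_{(x,i)} h_{x,x+eᵢ}`** on the `L × L` torus, `L ≥ 3` (each edge is exactly one directed bond). -/
theorem hcbHamiltonian_eq_neg_sum_xxzBond (hL : 3 ≤ L) (Δ : ℝ) :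
    hcbHamiltonian L Δ = -∑ p : TorusSite 2 L × Fin 2, xxzBond L Δ p.1 (p.1 + Pi.single p.2 1) := by
  unfold hcbHamiltonian xxzHamiltonian
  rw [sum_edge_eq_sum_bond hL]
  simp only [Sym2.lift_mk, xxzBond]
  push_cast
  rw [neg_one_smul]

/-! ## Adjoint and supports -/

/-- **`j_{xy}ᴴ = −j_{xy}`** for `x ≠ y` (the tree's `bondCurrent` is `i`× the physical current). -/
theorem bondCurrent_conjTranspose {x y : TorusSite 2 L} (hxy : x ≠ y) :
    (bondCurrent L x y)ᴴ = -bondCurrent L x y := by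
  unfold bondCurrent
  have h0 := (siteSpin_isHermitian (Λ := TorusSite 2 L) 1 x 0).eq
  have h1 := (siteSpin_isHermitian (Λ := TorusSite 2 L) 1 x 1).eq
  have h0' := (siteSpin_isHermitian (Λ := TorusSite 2 L) 1 y 0).eq
  have h1' := (siteSpin_isHermitian (Λ := TorusSite 2 L) 1 y 1).eq
  have c1 : siteSpin 1 y 1 * siteSpin 1 x 0 = (siteSpin 1 x 0 * siteSpin 1 y 1 : Op (TorusSite 2 L) 2) :=
    (siteSpin_commute_of_ne_holds 1 hxy 0 1).eq.symm
  have c2 : siteSpin 1 y 0 * siteSpin 1 x 1 = (siteSpin 1 x 1 * siteSpin 1 y 0 : Op (TorusSite 2 L) 2) :=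
    (siteSpin_commute_of_ne_holds 1 hxy 1 0).eq.symm
  rw [conjTranspose_smul, conjTranspose_sub, conjTranspose_mul, conjTranspose_mul, h0, h1, h0', h1', c1, c2]
  rw [show star (-I) = I by simp, ← neg_smul, neg_neg]

/-- The bond current is supported on its two sites. -/
theorem isSupportedOn_bondCurrent (x y : TorusSite 2 L) :
    IsSupportedOn (bondCurrent L x y) ({x, y} : Finset (TorusSite 2 L)) := by
  unfold bondCurrent siteSpin
  have hx : ∀ a, IsSupportedOn (onSite x a : Op (TorusSite 2 L) 2) ({x, y} : Finset (TorusSite 2 L)) :=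
    fun a => IsSupportedOn.mono_holds (isSupportedOn_onSite_holds x a) (by simp)
  have hy : ∀ a, IsSupportedOn (onSite y a : Op (TorusSite 2 L) 2) ({x, y} : Finset (TorusSite 2 L)) :=
    fun a => IsSupportedOn.mono_holds (isSupportedOn_onSite_holds y a) (by simp)
  refine IsSupportedOn.smul ?_ _
  rw [sub_eq_add_neg, ← neg_one_smul ℂ (onSite x (spinVec 1 1) * onSite y (spinVec 1 0) : Op (TorusSite 2 L) 2)]
  exact (IsSupportedOn.mul_holds (hx _) (hy _)).add ((IsSupportedOn.mul_holds (hx _) (hy _)).smul _)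

/-- The XXZ bond term is supported on its two sites. -/
theorem isSupportedOn_xxzBond (Δ : ℝ) (x y : TorusSite 2 L) :
    IsSupportedOn (xxzBond L Δ x y) ({x, y} : Finset (TorusSite 2 L)) := by
  unfold xxzBond spinBond siteSpin
  have hx : ∀ a, IsSupportedOn (onSite x a : Op (TorusSite 2 L) 2) ({x, y} : Finset (TorusSite 2 L)) :=
    fun a => IsSupportedOn.mono_holds (isSupportedOn_onSite_holds x a) (by simp)
  have hy : ∀ a, IsSupportedOn (onSite y a : Op (TorusSite 2 L) 2) ({x, y} : Finset (TorusSite 2 L)) :=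
    fun a => IsSupportedOn.mono_holds (isSupportedOn_onSite_holds y a) (by simp)
  have hb : ∀ α : Fin 3, IsSupportedOn ((1 / 2 : ℂ) • (onSite x (spinVec 1 α) * onSite y (spinVec 1 α)
      + onSite y (spinVec 1 α) * onSite x (spinVec 1 α)) : Op (TorusSite 2 L) 2) ({x, y} : Finset _) :=
    fun α => ((IsSupportedOn.mul_holds (hx _) (hy _)).add (IsSupportedOn.mul_holds (hy _) (hx _))).smul _
  exact ((hb 0).add (hb 1)).add ((hb 2).smul _)

/-! ## Cauchy–Schwarz for `dotProduct` -/

/-- `|⟨ψ, w⟩| ≤ ‖ψ‖‖w‖` with `⟨ψ,w⟩ = star ψ ⬝ᵥ w`. -/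
theorem norm_star_dotProduct_le {ι : Type*} [Fintype ι] (ψ w : ι → ℂ) :
    ‖star ψ ⬝ᵥ w‖ ≤ ‖WithLp.toLp 2 ψ‖ * ‖WithLp.toLp 2 w‖ := by
  have h : star ψ ⬝ᵥ w = inner ℂ (WithLp.toLp 2 ψ) (WithLp.toLp 2 w) := by
    rw [EuclideanSpace.inner_toLp_toLp, dotProduct_comm]
  rw [h]
  exact norm_inner_le_norm _ _

/-- `|⟨ψ, Xψ⟩| ≤ ‖ψ‖·‖Xψ‖`. -/
theorem norm_star_dotProduct_mulVec_le {ι : Type*} [Fintype ι] (ψ : ι → ℂ) (X : Matrix ι ι ℂ) :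
    ‖star ψ ⬝ᵥ (X *ᵥ ψ)‖ ≤ ‖WithLp.toLp 2 ψ‖ * ‖WithLp.toLp 2 (X *ᵥ ψ)‖ :=
  norm_star_dotProduct_le ψ _

end Summit.HubbardSuperconductivity.HubbardSuperconductivity.Theorems.AnisotropyChord.Stiffness
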